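import Summits.BirchSwinnertonDyer.Rank1Residual.O5.HeegnerLogTransportThreeTwoSidedRow430425o1Models
import Summits.BirchSwinnertonDyer.Rank1Residual.O5.HeegnerLogTransportThreeTwoSidedRow240930b1
import Summits.BirchSwinnertonDyer.Rank1Residual.O5.HeegnerLogTransportThreeLogUnitCert
import Literature.NumberTheory.EllipticCurves.AdditiveReductionSemistableModelProofs
import HarnessLib
import HarnessLib.Audit.Tags

/-!
# (t′) at `p = 3` — the TWO-SIDED END on the row `430425o1 ~ 47825d1` (`d_K = −344`), ROW file (§4, §4b, §5): the twist, the conductor numerals /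
# `klSet` units, and the row END (o5-r2 GEN 27, part 25e; §§1–3 = the sibling MODELS file `O5/HeegnerLogTransportThreeTwoSidedRow430425o1Models.lean`)

HONEST FRAMING. Research route; **O5 ((t′): additive potentially-supersingular reduction at an
anomalous prime) stays OPEN**; conditional on the displayed hypotheses; nothing booked; no
RESIDUAL-MAP mark, label, count or tier moves. This file contains NO new mathematics about (t′): it
instantiates the two-sided END `o5_index_unit_of_goodOrd_companion_cited_s0d_ladder` (part 25b) on the
THIRD (and last) of the three KL3 pairs on which all its finitary binders hold (o5-r2 GEN 27 memo, FINDING B;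
census EVIDENCE, never a Literature fact) and discharges those binders by kernel computation (`decide +kernel`
on integer / rational certificates; no `native_decide`), exactly as parts 25c/25d did:
(the per-binder bullets for `W`, the PAIR and `G` are in the MODELS file's module text, VERBATIM; the `Gd` bullet, the honest STILL-DISPLAYS list,
the references and the provenance line follow here VERBATIM)

* `Gd = [0, −86, 0, −116915968, 489834358272]` — the tree's own model `G.quadraticTwist (−344)` (variable change
  `1`), globally minimal (at `2`: `v₂(Δ) = 18`, `2⁴ ∣ c₄`, minimal by the integer Kraus test; Kodaira `I₈*`,
  `c ∈ {2, 4}`; `I₀*` at `5` (`c = 2`) and at `43` (`c = 4`), `I₁` at `1913`): `IsElliptic`, `IsGloballyMinimal`, `hGd`,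
  `htamGd : 3 ∤ ∏ c_ℓ(Gd)` (every value of the bracket `{2,4}·{1,2,4}·{1,2,4}·{1}` is a power of `2`),
  `hd : d_K = −344 < −4`.

What the row END `o5_index_unit_row430425o1` STILL DISPLAYS (honest list): the published theorems BY NAME
(`hKL`, `hYZ` PUB*, `hW20`, `hmod`, `hGZK`, `hKoG`, `hGZG`); `hρ` (`ρ̄_{W,3}` onto; instrument); the Heegner /
modular-parametrisation data over a field `K` with `d_K = −344` and the non-torsion of the two Heegner points;
the two sharp `3`-descents `hSelG`, `hSelGd`; the Manin binders `hcD`, `hc3′`. Generator of every certificate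
below: `census/row_certs.py` (self-tested on part 25c's row), reusing UNCHANGED the observatory's `tate_deep` /
`tam.py`, n1011-p18's `certs_lib`, o5-r2 GEN 26's `ladder_logcert.py` and GEN 27's `x3e_search.py`.

References: [cite: SilvermanAEC2009, III.2.3, VII.1 Remark 1.1, VII.5 Prop. 5.1 and VII.2.2]
[cite: Silverman1994, IV.9.4, IV.10.2 and IV.11.1] [cite: Tate1975, §7] [cite: Kraus1989, Prop. 1 and Prop. 2]
[cite: SilvermanAEC2009, §C.16 (definition of L_v(T))]
[cite: CremonaAlgorithms1997, §3.2 and Table 1] [cite: KrizLi2019, Theorem 1.16 (arXiv:1609.06687v4 pp. 7-8)]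
[cite: Fisher2012Hessian, Thm. 13.2 (n = 3)] [cite: KrausOesterle1992, Prop. 3 (i) ⇒ (iii) (pp. 262–263)]
[cite: GrossZagier1986, Thm. I.6.3] [cite: Kolyvagin1990, Thm. A]

Typed by `planner-b2b-bsdres-o5-r2-g27-0` (o5-r2 GEN 27, part 25e). Target path
`O5/HeegnerLogTransportThreeTwoSidedRow430425o1.lean` (NEW leaf; imports part 25c, the built part 24 §5
`…LogUnitCert` and the Literature leaf `AdditiveReductionSemistableModelProofs`). Nothing booked.

### cc-typer-5 GEN 20 (O5 §3.5 / O6 §3.4 typer of record) — by-name ask A-O5-G27-1 EXTENDED of o5-r2 GEN 27 (HOME/INBOX.md l.15032 P.S.: 'THEN PART 25d bd3db9fb8fdb2ae1 → NEW leaf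
`O5/HeegnerLogTransportThreeTwoSidedRow149895d1.lean` and PART 25e 2a28f986143af1db → NEW leaf `O5/HeegnerLogTransportThreeTwoSidedRow430425o1.lean`'; l.15040 P.S. 2 offers
pre-split CERT/END halves and adds 'if you prefer your own split of those, no objection either — by sha, byte-identical declaration blocks, or not at all'; the UNSPLIT texts
'remain the reference'); memo `HOME/b2b-bsdres-o5-r2/gen27/O5-GEN27.md`; order of record 25 p361579 → 25b p362101 → 25c MODELS p362747 / ROW p363319 → 25d → 25e → part 26.

Source: `HOME/b2b-bsdres-o5-r2/gen27/lean/HeegnerLogTransportThreeTwoSidedRow430425o1.lean` sha16 `2a28f986143af1db` (472 l., the UNSPLIT reference text; `gen27/SHA16.txt`; o5-r2's joint scratch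
`gen27/lean/scratch/concat_25_25b_25c_25d_25e.lean` 1dfe05c640d653b3 farm rc 0 / 0 warn / 0 sorry, axioms of both row ENDs standard, negative control `probe_false.lean` rejected),
re-hashed by the typer right before writing.  SPLIT (typer; 472 lines exceed the gate's 400-line `lint.size` for NEW files; the TYPER'S OWN split, in the SAME shape as 25c so that
the module holding the row END keeps the ASKED name and part 26's three `import …TwoSidedRow…` lines resolve byte-identically — o5-r2's pre-split halves use a `…Cert` sibling
whose name the 25c placement did not create): every declaration block byte-identical to the UNSPLIT source and in source order, SAME namespaces
`…O5.HeegnerLogTransport[.KL3TwoSidedRows]` (every FQN is the source's); script `class-closure/typer-5/gen20/g27rows_split.py`, anchors located by content and asserted: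
  MODELS = `O5/HeegnerLogTransportThreeTwoSidedRow430425o1Models.lean` = source l.1–59 (imports + module text UNCHANGED) + this ¶ + l.60–302 (§1 the three models + `IsElliptic` / `IsGloballyMinimal` +
           integral models, §1b `hcong` UNCONDITIONAL from the X3E certificate, §2 `hadd` / `htam`, §3 `htamG` / `hordG` / `nsCount` / the unit-log ladder `steps_…` / `xf_…` / `yf_…`
           + `logUnitOKQ` check) + `end KL3TwoSidedRows` + `end …HeegnerLogTransport`; curve / ladder `def`s ⇒ kind definition (async-audit lane).  ONE TYPER LINT EDIT (gate-forced,
           the same `lint.docstring` as 25c MODELS p362747): a one-line docstring before each of the three `instance : _.IsGloballyMinimal := …` lines (source l.151–153);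
  ROW    = `O5/HeegnerLogTransportThreeTwoSidedRow430425o1.lean` (the ASKED module name; holds the row END) = `import …HeegnerLogTransportThreeTwoSidedRow430425o1Models` (+ the source's other imports) + a header assembled
           from source l.11–17 / l.37–59 VERBATIM + this ¶ + source l.62–93 (`open`s, namespaces) + l.303–472 VERBATIM (§4 the twist: `hGd`,
           `htamGd`; §4b conductor numerals, local signs, `hunitW` / `hunitG` incl. the source's scoped `Fact (Nat.Prime _)` instance; `end KL3TwoSidedRows`; §5 the row END);
           theorems + one scoped instance ⇒ kind as the gate infers.
  THIS file = ROW (MODELS = p365390, this seat, in the tree).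
Checks by the typer before each proposal: DEDUP `lean search --decl` none; standalone farm `lean check` on TREE imports (rc 0 / 0 warnings / 0 sorries; ROW after MODELS'
olean — joint concat scratch meanwhile), `#print axioms` of the row END standard, dry-run clean; imports in the tree: 25c ROW `…TwoSidedRow240930b1` (p363319), part 24 CERT
`…LogUnitCert` (p360315), Literature `AdditiveReductionSemistableModelProofs`.  CONTENT LABELS (source, unchanged): curve-literal and ladder-data `def`s + instances + theorems
(`decide +kernel` / `norm_num`, no `native_decide`), 0 `@[conjecture]`, 0 Literature facts (net named-fact debt 0), no `sorry`; per-pair EVIDENCE made kernel-exact for ONE row;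
the row END stays CONDITIONAL on the displayed published theorems BY NAME + `hρ` + Heegner data + the two 3-descents + Manin binders (the module text's honest list).
HONEST FRAMING (cell `b2b-bsdres`): research route, lane CLASS-CLOSURE §3.5 O5; nothing booked, no mark / label / count / tier of `RESIDUAL-MAP.md` moves; census (FINDING A / B)
= EVIDENCE, never a Literature fact; O5 OPEN.
-/

open scoped Classical

open WeierstrassCurve Literature.NumberTheory.EllipticCurves
  Literature.NumberTheory.EllipticCurves.ModularForms
  Literature.NumberTheory.EllipticCurves.Rank1Residual
  Literature.NumberTheory.EllipticCurves.Rank1Residual.Typed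
open Literature.NumberTheory.EllipticCurves.Rank1Residual.X11RankOneCertificates (countPoints)
open Literature.NumberTheory.EllipticCurves.Fisher2012 (hesseC4three hesseC6three eval_hesseC4three eval_hesseC6three)
open Summit.BirchSwinnertonDyer.BirchSwinnertonDyer.Rank1Residual.IntModel (integralModelInt_eq_of_map_eq
  minimalDiscriminantInt_eq hasMultiplicativeReductionAtPrime_of_intModel hasSplitMultiplicativeReductionAtPrime_of_intModel_of_root
  not_hasSplitMultiplicativeReductionAtPrime_of_intModel_of_noroot)
open Summit.BirchSwinnertonDyer.Rank1Residual.Supersingular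
  (QStep ladderRunQ qScalar reductionPointCount_eq_of_intModel_countPoints)
open Summit.BirchSwinnertonDyer.Rank1Residual.Additive (addv_of_intModel)
open Summit.BirchSwinnertonDyer.Rank1Residual.Additive.IntModelTam
  (not_dvd_tamagawaProduct_of_intModel_of_rowCheck)
open Summit.BirchSwinnertonDyer.Rank1Residual.Additive.IntModelCond (conductorNorm_eq_of_intModel_of_certs_of_eq)
open Summit.BirchSwinnertonDyer.BirchSwinnertonDyer.Rank2Observatory.Tam (TamLocal)
open Summit.BirchSwinnertonDyer.Rank1Residual.SecondDescent (goodOrd_of_intModel)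
open Summit.BirchSwinnertonDyer.Rank1Residual.X11b
  (isGloballyMinimal_of_krausCriterion_support natCard_point_eq_countPoints)
open Summit.BirchSwinnertonDyer.Rank1Residual.Additive.LocalLog
open Summit.BirchSwinnertonDyer.Rank1Residual.X1.CongruenceTransfer (TorsionIso)
open Literature.NumberTheory.EllipticCurves.Fisher2012 (threeCongruent_of_hesseCertificate_unconditional)
open IsDedekindDomain (HeightOneSpectrum)
open Rat.HeightOneSpectrum (primesEquiv)
open scoped NumberField

namespace Summit.BirchSwinnertonDyer.Rank1Residual.O5.HeegnerLogTransport

namespace KL3TwoSidedRows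

/-! ### §4 The twist `G^(−344)`: `hGd`, `htamGd` in the kernel -/

/-- **`hGd` IN THE KERNEL**: the identity variable change carries the tree's model `47825d1.quadraticTwist (−344) =
⟨0, −344·b₂/4, 0, 344²·b₄/2, −344³·b₆/4⟩` (`b₂, b₄, b₆ = 1, −1976, −48132`) to `Gd344` (they are equal).
[cite: SilvermanAEC2009, III.1 and X.5.4] -/
theorem twist_G47825d1_344 :
    ∃ C : VariableChange ℚ, C • G47825d1.quadraticTwist ((-344 : ℤ) : ℚ) = Gd344 :=
  ⟨⟨1, 0, 0, 0⟩, by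
    ext <;> norm_num [WeierstrassCurve.variableChange_def, WeierstrassCurve.quadraticTwist, G47825d1, Gd344,
      WeierstrassCurve.b₂, WeierstrassCurve.b₄, WeierstrassCurve.b₆]⟩

/-- Stage-1 Tamagawa row certificate of `Gd344 = 47825d1^(−344)`: `2` `I₈*` (deep certificate, `(r,s,t) = (16,0,0)`, exit `72`,
round `3`, `c = 4 ∈ {2, 4}`), `5` `I₀*` (`(2,0,0)`, `c = 2 ∈ {1,2,4}`), `43` `I₀*` (`c = 4 ∈ {1,2,4}`), `1913` `I₁` non-split (`1`);
`|Δ| = 2¹⁸·5⁶·43⁶·1913`; engine `∏ c_ℓ = 32`. [cite: Silverman1994, IV.9.4] [cite: Tate1975, §7] -/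
theorem rowCheck_Gd344 :
    TamLocal.rowCheck [⟨2, 1, 5, 0, 16, 0, 0, 18, 72, 3, 4⟩, ⟨5, 2, 5, 0, 2, 0, 0, 6, 6, 0, 2⟩,
        ⟨43, 6, 5, 0, 0, 0, 0, 6, 6, 0, 4⟩, ⟨1913, 43, 3, 0, 0, 0, 0, 1, 0, 0, 1⟩]
      ⟨0, -86, 0, -116915968, 489834358272⟩ = true := by
  decide +kernel

/-- **`htamGd` IN THE KERNEL**: `3 ∤ ∏_ℓ c_ℓ(Gd344)` (every value of the certified bracket `{2,4}·{1,2,4}·{1,2,4}·{1}` is a power of `2`).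
[cite: Silverman1994, IV.9.4] [cite: Tate1975, §7] -/
theorem tam3_Gd344 : ¬ 3 ∣ Gd344.tamagawaProduct :=
  not_dvd_tamagawaProduct_of_intModel_of_rowCheck intModel_Gd344 rowCheck_Gd344 3 (by decide +kernel)

/-! ### §4b The pair's binders `hunitW`, `hunitG` in the kernel: conductor numerals `430425`, `47825`; `a₅ = 0` (ADDITIVE on
both sides) and `a₁₉₁₃ = −1` at the common bad primes, hence `klSet ⊆ {3}` on both sides -/

/-- **`a_p(W) = 0` at an ADDITIVE prime of the integral model** (`p ∣ Δ(E₀)`, `p ∣ c₄(E₀)`; the Euler factor at `p` is `1`):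
the tree's `WeierstrassCurve.lFunction_eq_zero_of_dvd_of_dvd` (Silverman VII.5.1(c) and §C.16) read on the integral
model through `IntModel.minimalDiscriminantInt_eq`. [cite: SilvermanAEC2009, VII.5 Prop. 5.1(c) and §C.16] -/
theorem lFunction_prime_eq_zero_of_intModel {W : WeierstrassCurve ℚ} [W.IsElliptic] [W.IsGloballyMinimal]
    {E₀ : WeierstrassCurve ℤ} (hI : integralModelInt W = E₀) (p : ℕ) [Fact p.Prime]
    (hΔ : (p : ℤ) ∣ E₀.Δ) (hc₄ : (p : ℤ) ∣ E₀.c₄) : W.LFunction p = 0 :=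
  W.lFunction_eq_zero_of_dvd_of_dvd p (by rw [minimalDiscriminantInt_eq hI]; exact hΔ) (by rw [hI]; exact hc₄)
    (dvd_refl p)

/-- **`N(430425o1) = 430425 = 3²·5²·1913` as a KERNEL numeral**: `RNCert3 = ⟨0, 4, 3, 9, 4, 6, [⟨5, 2, 6, 2, 2⟩, ⟨1913, 43, 1, 0, 0⟩]⟩`
(`5` additive with `v₅(c₄) = 2`, `f₅ = 2`; `1913` non-split), local certificates `⟨0, …⟩` at `2` (GOOD) and `⟨3, 3, 0, 13, 9, 9, 0⟩` at `3`
(deep: Kodaira `III*`, `f₃ = 2`). Generator: `census/row_certs.py`. [cite: Silverman1994, IV.9.4, IV.10.2 and IV.11.1]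
[cite: CremonaAlgorithms1997, Table 1 (430425o1)] -/
theorem conductorNorm_W430425o1 : W430425o1.conductorNorm ℤ = 430425 :=
  conductorNorm_eq_of_intModel_of_certs_of_eq intModel_W430425o1
    (c := ⟨0, 4, 3, 9, 4, 6, [⟨5, 2, 6, 2, 2⟩, ⟨1913, 43, 1, 0, 0⟩]⟩) (l₂ := ⟨0, 0, 0, 0, 0, 0, 0⟩)
    (l₃ := ⟨3, 3, 0, 13, 9, 9, 0⟩)
    (by decide +kernel) (by decide +kernel) (by decide +kernel) (by decide +kernel)

/-- **`N(47825d1) = 47825 = 5²·1913` as a KERNEL numeral** (good at `2` and `3`, additive at `5`): `RNCert3 = ⟨0, 0, 0, 0, 0, 0,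
[⟨5, 2, 6, 2, 2⟩, ⟨1913, 43, 1, 0, 0⟩]⟩`, local certificates `⟨0, …⟩` at `2` and at `3`.
[cite: Silverman1994, IV.10.2 and IV.11.1] [cite: CremonaAlgorithms1997, Table 1 (47825d1)] -/
theorem conductorNorm_G47825d1 : G47825d1.conductorNorm ℤ = 47825 :=
  conductorNorm_eq_of_intModel_of_certs_of_eq intModel_G47825d1
    (c := ⟨0, 0, 0, 0, 0, 0, [⟨5, 2, 6, 2, 2⟩, ⟨1913, 43, 1, 0, 0⟩]⟩) (l₂ := ⟨0, 0, 0, 0, 0, 0, 0⟩)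
    (l₃ := ⟨0, 0, 0, 0, 0, 0, 0⟩)
    (by decide +kernel) (by decide +kernel) (by decide +kernel) (by decide +kernel)

/-- `1913` is prime (instance for `ZMod 1913` as a field; scoped to this namespace). [folklore] -/
scoped instance fact_prime_1913 : Fact (Nat.Prime 1913) := ⟨by norm_num⟩

/-- `a₅(430425o1) = 0` (ADDITIVE `I₀*`: `5 ∣ Δ`, `5 ∣ c₄`). [cite: SilvermanAEC2009, §C.16] -/
theorem lFunction_W430425o1_5 : W430425o1.LFunction 5 = 0 :=
  lFunction_prime_eq_zero_of_intModel intModel_W430425o1 5 (by decide +kernel) (by decide +kernel)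

/-- `a₁₉₁₃(430425o1) = −1` (`I₁` non-split: root-free mod `1913`, by exhaustion in the kernel). [cite: SilvermanAEC2009, §C.16] -/
theorem lFunction_W430425o1_1913 : W430425o1.LFunction 1913 = -1 :=
  lFunction_prime_eq_neg_one_of_intModel_of_noroot intModel_W430425o1 1913 (by decide +kernel) (by decide +kernel)
    (by decide +kernel)

/-- `a₅(47825d1) = 0` (ADDITIVE `I₀*`: `5 ∣ Δ`, `5 ∣ c₄`). [cite: SilvermanAEC2009, §C.16] -/
theorem lFunction_G47825d1_5 : G47825d1.LFunction 5 = 0 :=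
  lFunction_prime_eq_zero_of_intModel intModel_G47825d1 5 (by decide +kernel) (by decide +kernel)

/-- `a₁₉₁₃(47825d1) = −1` (`I₁` non-split). [cite: SilvermanAEC2009, §C.16] -/
theorem lFunction_G47825d1_1913 : G47825d1.LFunction 1913 = -1 :=
  lFunction_prime_eq_neg_one_of_intModel_of_noroot intModel_G47825d1 1913 (by decide +kernel) (by decide +kernel)
    (by decide +kernel)

/-- The primes of `3·N·N′ = 3³·5⁴·1913²` are `3, 5, 1913`. [folklore] -/
theorem eq_of_prime_dvd_level_430425o1 {ℓ : ℕ} (hℓ : ℓ.Prime) (h : ℓ ∣ 3 * 430425 * 47825) :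
    ℓ = 3 ∨ ℓ = 5 ∨ ℓ = 1913 := by
  have h' : ℓ ∣ 3 ^ 3 * 5 ^ 4 * 1913 ^ 2 := by norm_num at h ⊢; exact h
  rcases (Nat.Prime.dvd_mul hℓ).mp h' with h1 | h1
  · rcases (Nat.Prime.dvd_mul hℓ).mp h1 with h2 | h2
    · exact Or.inl ((Nat.prime_dvd_prime_iff_eq hℓ Nat.prime_three).mp (hℓ.dvd_of_dvd_pow h2))
    · exact Or.inr (Or.inl ((Nat.prime_dvd_prime_iff_eq hℓ (by norm_num)).mp (hℓ.dvd_of_dvd_pow h2)))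
  · exact Or.inr (Or.inr ((Nat.prime_dvd_prime_iff_eq hℓ (by norm_num)).mp (hℓ.dvd_of_dvd_pow h1)))

/-- **`hunitW` for the row IN THE KERNEL** — vacuously: every prime `ℓ ≠ 3` of `3·N·N′` divides both conductors with
`a_ℓ(430425o1) = a_ℓ(47825d1)` (`0` at the additive prime `5`, `−1` at `1913`), so `klSet W G = {3}`.
[cite: KrizLi2019, Thm. 1.16 (the set `ℓ ∣ pNN′/M`)] -/
theorem hunitW_row430425o1 :
    ∀ ℓ ∈ klSet W430425o1 G47825d1, ℓ ≠ 3 → padicValInt 3 (nsCount W430425o1 ℓ) = 0 := by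
  intro ℓ hℓ h3
  exfalso
  rw [klSet, Finset.mem_filter, conductorNorm_W430425o1, conductorNorm_G47825d1] at hℓ
  obtain ⟨hmem, h⟩ := hℓ
  have hcases := eq_of_prime_dvd_level_430425o1 (Nat.prime_of_mem_primeFactors hmem)
    (Nat.dvd_of_mem_primeFactors hmem)
  rcases h with h | h
  · exact h3 h
  rcases hcases with rfl | rfl | rfl
  · exact h3 rfl
  · exact h ⟨by norm_num, by norm_num, by rw [lFunction_W430425o1_5, lFunction_G47825d1_5]⟩
  · exact h ⟨by norm_num, by norm_num, by rw [lFunction_W430425o1_1913, lFunction_G47825d1_1913]⟩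

/-- **`hunitG` for the row IN THE KERNEL** (roles swapped: `klSet G W = {3}`). [cite: KrizLi2019, Thm. 1.16 (the set `ℓ ∣ pNN′/M`)] -/
theorem hunitG_row430425o1 :
    ∀ ℓ ∈ klSet G47825d1 W430425o1, ℓ ≠ 3 → padicValInt 3 (nsCount G47825d1 ℓ) = 0 := by
  intro ℓ hℓ h3
  exfalso
  rw [klSet, Finset.mem_filter, conductorNorm_W430425o1, conductorNorm_G47825d1] at hℓ
  obtain ⟨hmem, h⟩ := hℓ
  have hcases := eq_of_prime_dvd_level_430425o1 (Nat.prime_of_mem_primeFactors hmem)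
    (by have := Nat.dvd_of_mem_primeFactors hmem; norm_num at this ⊢; exact this)
  rcases h with h | h
  · exact h3 h
  rcases hcases with rfl | rfl | rfl
  · exact h3 rfl
  · exact h ⟨by norm_num, by norm_num, by rw [lFunction_W430425o1_5, lFunction_G47825d1_5]⟩
  · exact h ⟨by norm_num, by norm_num, by rw [lFunction_W430425o1_1913, lFunction_G47825d1_1913]⟩

end KL3TwoSidedRows

open KL3TwoSidedRows

/-! ### §5 The two-sided END on the row `430425o1 ~ 47825d1`, `d_K = −344` -/

/-- **THE TWO-SIDED END ON THE ROW `430425o1 ~ 47825d1`** — `o5_index_unit_of_goodOrd_companion_cited_s0d_ladder`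
(part 25b) with `W := 430425o1`, `G := 47825d1` (ANOMALOUS good-ordinary companion), `Gd := Gd344` and EVERY finitary
binder DISCHARGED IN THE KERNEL (§§1–4b: `IsElliptic`, `IsGloballyMinimal` ×3, `hcong` (X3E `(0:1)`, `u = 540`,
unconditional), `hadd`, `htam`, `htamG`, `hordG`, `htamGd`, `hGd`, `hd`, `hunitW`, `hunitG` (with the ADDITIVE common
prime `5`: `a₅ = 0` on both sides), and the unit-log certificate `h₀, steps, hrun, hk, hx, hmk` with `m = 3`, `k = 1`).
For EVERY imaginary quadratic field `K` with `d_K = −344` (`3` split, Heegner for `N`, `N′`), every pair of modular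
parametrisations / Heegner data and both embeddings: `ρ̄_{W,3}` onto, Kolyvagin + Gross–Zagier for `G/K`, the
non-torsion of the two Heegner points, the two sharp `3`-descents of `G` and `Gd344`, the Manin binders and the five
published theorems BY NAME give `ord₃ [W(K) : ℤ P_K] = 0`. Conditional theorem; research route; O5 OPEN; nothing booked.
[cite: KrizLi2019, Theorem 1.16 (arXiv:1609.06687v4 pp. 7-8)] [cite: GrossZagier1986, Thm. I.6.3]
[cite: Kolyvagin1990, Thm. A] [cite: YanZhu2026, Theorem 4.15] [cite: Fisher2012Hessian, Thm. 13.2 (n = 3)]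
[cite: KrausOesterle1992, Prop. 3 (i) ⇒ (iii) (pp. 262–263)] [cite: SilvermanAEC2009, IV.6.4, VII.2.2 and X.5.4] -/
theorem o5_index_unit_row430425o1
    (hKL : KrizLi2019.thm116_padicLogHeegner_congruence)
    (hYZ : YanZhu2026.thm415_padicValRat_bsd_rank_le_one)
    (hW20 : Wuthrich2014.lemma20_surjective_threeAdic_of_semistable)
    (hmod : exists_isNewformOf) (hGZK : rank_eq_analyticRank_of_analyticRank_le_one)
    (hρ : W430425o1.HasSurjectiveModNGaloisRep 3)
    {N N' : ℕ} [NeZero N] [NeZero N'] (D : ModularParametrizationData W430425o1 N)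
    (D' : ModularParametrizationData G47825d1 N')
    (K : Type) [Field K] [NumberField K] (hK : IsImaginaryQuadratic K) (hdK : NumberField.discr K = -344)
    (hH : SatisfiesHeegnerHypothesis N K) (hH' : SatisfiesHeegnerHypothesis N' K)
    (h3K : SatisfiesHeegnerHypothesis 3 K)
    (hKoG : kolyvagin N' G47825d1 K) (hGZG : gross_zagier N' G47825d1 K)
    (H : HeegnerDatum N (NumberField.discr K)) (H' : HeegnerDatum N' (NumberField.discr K))
    (ι : K →+* ℂ) (ι₃ : K →+* ℚ_[3])
    (P : (W430425o1.baseChange K).toAffine.Point) (P' : (G47825d1.baseChange K).toAffine.Point)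
    (hP : WeierstrassCurve.Affine.Point.map ι.toRatAlgHom P = heegnerPointComplex D H)
    (hP' : WeierstrassCurve.Affine.Point.map ι.toRatAlgHom P' = heegnerPointComplex D' H')
    (hPinf : ¬ IsOfFinAddOrder P) (hP'inf : ¬ IsOfFinAddOrder P')
    (hSelG : Nat.card (G47825d1.selmerGroup (3 : ℤ)) = 3 ^ G47825d1.mordellWeilRank)
    (hSelGd : Nat.card (Gd344.selmerGroup (3 : ℤ)) = 3 ^ Gd344.mordellWeilRank)
    (hcD : padicValInt 3 D.maninConstant = 0) (hc3' : ¬ ((3 : ℤ) ∣ D'.maninConstant)) :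
    padicValNat 3 (AddSubgroup.zmultiples P).index = 0 :=
  o5_index_unit_of_goodOrd_companion_cited_s0d_ladder hKL hYZ hW20 hmod hGZK W430425o1 G47825d1
    isCongruentModThree_430425o1_47825d1 hρ
    addv3_W430425o1 hunitW_row430425o1 hunitG_row430425o1 tam3_W430425o1 tam3_G47825d1 goodOrd3_G47825d1 Gd344
    tam3_Gd344 D D' K hK hH hH' h3K hKoG hGZG (by rw [hdK]; norm_num) (by rw [hdK]; exact twist_G47825d1_344) H H' ι ι₃
    P P' hP hP' hPinf hP'inf nonsingular_G47825d1_Q₀ steps_G47825d1 ladder_G47825d1 (k := 1) one_pos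
    padicValRat_x_three_Q₀_G47825d1 hmk_G47825d1 hSelG hSelGd hcD hc3'

end Summit.BirchSwinnertonDyer.Rank1Residual.O5.HeegnerLogTransport
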